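import Summits.Ventures.CertifiedManyBodySolver.Observables.StiffnessVirtualStation
import HarnessLib

/-!
# Ventures/CertifiedManyBodySolver — Observables/StiffnessVirtualStationBoxes.lean

HONEST FRAMING: one-sided certified CEILINGS on the uniform flux stiffness (t–t′ f-sum class), AREA form (boxes) of the «VIRTUAL STATION» leaf of the companion
`Observables/StiffnessVirtualStation.lean` (target-side `U`-chord × one kernel Fermi-sea row, both read on the target state); every leaf is CONDITIONAL on the rows
it names; a ceiling never speaks to the presence of order; not a `T_c` estimate, not a superconductivity verdict; no number of record. Zero compute, no definition,
no claim node, no `sorry`.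

Cell `pub/hubbard-fast` (D-0154 (1)(A) «CERTIFICATE REUSE along parameter paths»), seat `hubbard-fast-reuse-2` g9 (`prover-hubbard-fast-reuse-2-g9-0`), line «VIRTUAL STATION».

THE POINT. With a `t′`-INDEPENDENT cap `H` valid on a box `[U_a, U_b] × [t_a, t_b]` (at `n = 1` the `t′ = 0` cap of a coupling `U₂ ≥ U_b`; at doped densities a cap plane
frozen at the box's far `t′`), the cleared word inequality of the companion's `…_left_cleared` / `…_right_cleared`,
`P(U, t′) = 4c(K − κ₂d) + (2t′ − κ₂)(U·lo₁ − U₁·H) + ℓ₂(K − 2t′d)` (`K = U·t′₁ − U₁·t′`, `d = U − U₁`), is AFFINE in `U` at fixed `t′` and AFFINE in `t′` at fixed `U`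
(bilinear), and so is the bracket orientation `2t′d ≤ K`; both therefore interpolate from the FOUR CORNERS with the bilinear weights (`box_corner_interp`), and the point
leaf applies at every point of the box. One box = four decidable corner inequalities.

* `box_corner_interp`; `ObsStiffnessSeqCeilingAt_on_box_of_targetUChord_fermiSeaRow_left` (`κ₂ < 2t′ ≤ κ`) / `…_right` (`κ ≤ 2t′ < κ₂`) — any density, any `t′₁`, cap `H`
  supplied on the box; `…_on_box_halfFilling_targetUChord_left` / `…_right` — `n = 1`, source at a `t′ = 0` station, cap from the `t′ = 0` column at `U₂ ≥ U_b`
  (`energyDensityTT'_halfFilling_cap_of_tPrime_zero_cap_above`), either sign of `t′`, ALL SIDES.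

NOT said: the box word is the corner maximum only because the cap is frozen; a `t′`-dependent cap plane makes `P` quadratic in `t′` (not treated here); nothing at `T > 0`.

References: T. Koma, H. Tasaki, J. Stat. Phys. 76 (1994) 745, §1 [KomaTasaki1994]; D. J. Scalapino, S. R. White, S.-C. Zhang, PRB 47 (1993) 7995, §II
[ScalapinoWhiteZhang1993]; E. H. Lieb, M. Loss, Duke Math. J. 71 (1993) 337, §8 Theorem 8.2 [LiebLoss1993]; E. H. Lieb, F. Y. Wu, Physica A 321 (2003) 1,
§1 eq. (3) [LiebWuPhysicaA2003].
-/

noncomputable section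

namespace Summit.Ventures.CertifiedManyBodySolver.Observables

open Literature.MathematicalPhysics.QuantumLattice
open Literature.MathematicalPhysics.QuantumLattice.ThermodynamicLimit
open Literature.MathematicalPhysics.QuantumFieldTheory
open Literature.Probability.LatticeModels
open Matrix Finset Filter Topology HubbardWave0
open scoped Matrix BigOperators ComplexOrder

/-! ## §1 THE BOX THEOREMS: with a `t′`-independent cap on the box the cleared word inequality is bilinear — four corners word the box -/

/-- **Four-corner interpolation**: nonnegative corner values with the bilinear weights of a point of the box sum to a nonnegative number. [folklore] -/
theorem box_corner_interp {Ua Ub ta tb U t P₁ P₂ P₃ P₄ : ℝ} (hU : U ∈ Set.Icc Ua Ub) (ht : t ∈ Set.Icc ta tb)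
    (h₁ : 0 ≤ P₁) (h₂ : 0 ≤ P₂) (h₃ : 0 ≤ P₃) (h₄ : 0 ≤ P₄) :
    0 ≤ (Ub - U) * (tb - t) * P₁ + (Ub - U) * (t - ta) * P₂ + (U - Ua) * (tb - t) * P₃ + (U - Ua) * (t - ta) * P₄ := by
  obtain ⟨hUa, hUb⟩ := hU
  obtain ⟨hta, htb⟩ := ht
  have := mul_nonneg (mul_nonneg (sub_nonneg.2 hUb) (sub_nonneg.2 htb)) h₁
  have := mul_nonneg (mul_nonneg (sub_nonneg.2 hUb) (sub_nonneg.2 hta)) h₂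
  have := mul_nonneg (mul_nonneg (sub_nonneg.2 hUa) (sub_nonneg.2 htb)) h₃
  have := mul_nonneg (mul_nonneg (sub_nonneg.2 hUa) (sub_nonneg.2 hta)) h₄
  linarith

section Box

variable {n t₁ U₁ : ℝ}

/-- **BOX WORD, Fermi-sea row LEFT** (`κ₂ < 2t′ ≤ κ` on the box; the `t′ ≤ 0` side of a `t′₁ = 0` source). Floor `lo₁ ≤ e(1, t′₁, U₁, n)`, `0 ≤ U₁ < U_a < U_b`,
`t_a < t_b`; a cap `H` valid at EVERY point of the box (`e(1, t′, U, n) ≤ H`); a free-gas floor `ℓ₂ ≤ e(1, κ₂, 0, n)` with `κ₂ < 2t_a`; the bracket orientation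
`2t′d ≤ K` (`K = U·t′₁ − U₁·t′`, `d = U − U₁`) at the four corners; and the cleared word inequality
`P(U, t′) = 4c(K − κ₂d) + (2t′ − κ₂)(U·lo₁ − U₁·H) + ℓ₂(K − 2t′d) ≥ 0` at the FOUR CORNERS. Then `ObsStiffnessSeqCeilingAt t′ U n c` at every point of the box:
`P` and the orientation are affine in `U` at fixed `t′` and affine in `t′` at fixed `U`, so they interpolate from the corners (`box_corner_interp`), and §2 applies.
[cite: KomaTasaki1994, §1] [cite: ScalapinoWhiteZhang1993, §II] [cite: LiebLoss1993, §8, Theorem 8.2] -/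
theorem ObsStiffnessSeqCeilingAt_on_box_of_targetUChord_fermiSeaRow_left (hU₁0 : 0 ≤ U₁) (hn0 : 0 ≤ n) (hn2 : n < 2)
    {lo₁ : ℝ} (hfloor : lo₁ ≤ energyDensityTT' 1 t₁ U₁ n) {κ₂ ℓ₂ : ℝ} (h₂ : ℓ₂ ≤ energyDensityTT' 1 κ₂ 0 n)
    {Ua Ub ta tb H : ℝ} (hUa : U₁ < Ua) (hab : Ua < Ub) (htab : ta < tb) (hτ : κ₂ < 2 * ta)
    (hcapbox : ∀ U ∈ Set.Icc Ua Ub, ∀ t ∈ Set.Icc ta tb, energyDensityTT' 1 t U n ≤ H)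
    (hbr₁ : 2 * ta * (Ua - U₁) ≤ Ua * t₁ - U₁ * ta) (hbr₂ : 2 * tb * (Ua - U₁) ≤ Ua * t₁ - U₁ * tb)
    (hbr₃ : 2 * ta * (Ub - U₁) ≤ Ub * t₁ - U₁ * ta) (hbr₄ : 2 * tb * (Ub - U₁) ≤ Ub * t₁ - U₁ * tb) (c : ℚ)
    (hP₁ : 0 ≤ 4 * ((c : ℚ) : ℝ) * ((Ua * t₁ - U₁ * ta) - κ₂ * (Ua - U₁)) + (2 * ta - κ₂) * (Ua * lo₁ - U₁ * H) + ℓ₂ * ((Ua * t₁ - U₁ * ta) - 2 * ta * (Ua - U₁)))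
    (hP₂ : 0 ≤ 4 * ((c : ℚ) : ℝ) * ((Ua * t₁ - U₁ * tb) - κ₂ * (Ua - U₁)) + (2 * tb - κ₂) * (Ua * lo₁ - U₁ * H) + ℓ₂ * ((Ua * t₁ - U₁ * tb) - 2 * tb * (Ua - U₁)))
    (hP₃ : 0 ≤ 4 * ((c : ℚ) : ℝ) * ((Ub * t₁ - U₁ * ta) - κ₂ * (Ub - U₁)) + (2 * ta - κ₂) * (Ub * lo₁ - U₁ * H) + ℓ₂ * ((Ub * t₁ - U₁ * ta) - 2 * ta * (Ub - U₁)))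
    (hP₄ : 0 ≤ 4 * ((c : ℚ) : ℝ) * ((Ub * t₁ - U₁ * tb) - κ₂ * (Ub - U₁)) + (2 * tb - κ₂) * (Ub * lo₁ - U₁ * H) + ℓ₂ * ((Ub * t₁ - U₁ * tb) - 2 * tb * (Ub - U₁))) :
    ∀ U ∈ Set.Icc Ua Ub, ∀ t ∈ Set.Icc ta tb, ObsStiffnessSeqCeilingAt t U n c := by
  intro U hU t ht
  have hUlt : U₁ < U := hUa.trans_le hU.1
  have hpos : 0 < (Ub - Ua) * (tb - ta) := mul_pos (sub_pos.2 hab) (sub_pos.2 htab)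
  have hbr : 2 * t * (U - U₁) ≤ U * t₁ - U₁ * t := by
    have h := box_corner_interp hU ht (sub_nonneg.2 hbr₁) (sub_nonneg.2 hbr₂) (sub_nonneg.2 hbr₃) (sub_nonneg.2 hbr₄)
    have key : (Ub - Ua) * (tb - ta) * ((U * t₁ - U₁ * t) - 2 * t * (U - U₁)) =
        (Ub - U) * (tb - t) * ((Ua * t₁ - U₁ * ta) - 2 * ta * (Ua - U₁)) + (Ub - U) * (t - ta) * ((Ua * t₁ - U₁ * tb) - 2 * tb * (Ua - U₁)) +
        (U - Ua) * (tb - t) * ((Ub * t₁ - U₁ * ta) - 2 * ta * (Ub - U₁)) + (U - Ua) * (t - ta) * ((Ub * t₁ - U₁ * tb) - 2 * tb * (Ub - U₁)) := by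
      ring
    have hnn : 0 ≤ (Ub - Ua) * (tb - ta) * ((U * t₁ - U₁ * t) - 2 * t * (U - U₁)) := by rw [key]; exact h
    have := (mul_nonneg_iff_of_pos_left hpos).1 hnn
    linarith
  have hτ' : κ₂ < 2 * t := by linarith [ht.1]
  refine ObsStiffnessSeqCeilingAt_of_targetUChord_fermiSeaRow_left_cleared hU₁0 hUlt hn0 hn2 hfloor (hcapbox U hU t ht) h₂ hbr hτ' c ?_
  have h := box_corner_interp hU ht hP₁ hP₂ hP₃ hP₄
  have key : (Ub - Ua) * (tb - ta) * (4 * ((c : ℚ) : ℝ) * ((U * t₁ - U₁ * t) - κ₂ * (U - U₁)) + (2 * t - κ₂) * (U * lo₁ - U₁ * H) +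
      ℓ₂ * ((U * t₁ - U₁ * t) - 2 * t * (U - U₁))) =
      (Ub - U) * (tb - t) * (4 * ((c : ℚ) : ℝ) * ((Ua * t₁ - U₁ * ta) - κ₂ * (Ua - U₁)) + (2 * ta - κ₂) * (Ua * lo₁ - U₁ * H) + ℓ₂ * ((Ua * t₁ - U₁ * ta) - 2 * ta * (Ua - U₁))) +
      (Ub - U) * (t - ta) * (4 * ((c : ℚ) : ℝ) * ((Ua * t₁ - U₁ * tb) - κ₂ * (Ua - U₁)) + (2 * tb - κ₂) * (Ua * lo₁ - U₁ * H) + ℓ₂ * ((Ua * t₁ - U₁ * tb) - 2 * tb * (Ua - U₁))) +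
      (U - Ua) * (tb - t) * (4 * ((c : ℚ) : ℝ) * ((Ub * t₁ - U₁ * ta) - κ₂ * (Ub - U₁)) + (2 * ta - κ₂) * (Ub * lo₁ - U₁ * H) + ℓ₂ * ((Ub * t₁ - U₁ * ta) - 2 * ta * (Ub - U₁))) +
      (U - Ua) * (t - ta) * (4 * ((c : ℚ) : ℝ) * ((Ub * t₁ - U₁ * tb) - κ₂ * (Ub - U₁)) + (2 * tb - κ₂) * (Ub * lo₁ - U₁ * H) + ℓ₂ * ((Ub * t₁ - U₁ * tb) - 2 * tb * (Ub - U₁))) := by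
    ring
  have hnn : 0 ≤ (Ub - Ua) * (tb - ta) * (4 * ((c : ℚ) : ℝ) * ((U * t₁ - U₁ * t) - κ₂ * (U - U₁)) + (2 * t - κ₂) * (U * lo₁ - U₁ * H) +
      ℓ₂ * ((U * t₁ - U₁ * t) - 2 * t * (U - U₁))) := by rw [key]; exact h
  exact (mul_nonneg_iff_of_pos_left hpos).1 hnn

/-- **BOX WORD, Fermi-sea row RIGHT** (`κ ≤ 2t′ < κ₂` on the box; the `t′ ≥ 0` side of a `t′₁ = 0` source). Same data with `2t_b < κ₂`; corners: `K ≤ 2t′d` and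
`P′(U, t′) = 4c(κ₂d − K) + (κ₂ − 2t′)(U·lo₁ − U₁·H) + ℓ₂(2t′d − K) ≥ 0`. Then `ObsStiffnessSeqCeilingAt t′ U n c` on the whole box.
[cite: KomaTasaki1994, §1] [cite: ScalapinoWhiteZhang1993, §II] [cite: LiebLoss1993, §8, Theorem 8.2] -/
theorem ObsStiffnessSeqCeilingAt_on_box_of_targetUChord_fermiSeaRow_right (hU₁0 : 0 ≤ U₁) (hn0 : 0 ≤ n) (hn2 : n < 2)
    {lo₁ : ℝ} (hfloor : lo₁ ≤ energyDensityTT' 1 t₁ U₁ n) {κ₂ ℓ₂ : ℝ} (h₂ : ℓ₂ ≤ energyDensityTT' 1 κ₂ 0 n)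
    {Ua Ub ta tb H : ℝ} (hUa : U₁ < Ua) (hab : Ua < Ub) (htab : ta < tb) (hτ : 2 * tb < κ₂)
    (hcapbox : ∀ U ∈ Set.Icc Ua Ub, ∀ t ∈ Set.Icc ta tb, energyDensityTT' 1 t U n ≤ H)
    (hbr₁ : Ua * t₁ - U₁ * ta ≤ 2 * ta * (Ua - U₁)) (hbr₂ : Ua * t₁ - U₁ * tb ≤ 2 * tb * (Ua - U₁))
    (hbr₃ : Ub * t₁ - U₁ * ta ≤ 2 * ta * (Ub - U₁)) (hbr₄ : Ub * t₁ - U₁ * tb ≤ 2 * tb * (Ub - U₁)) (c : ℚ)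
    (hP₁ : 0 ≤ 4 * ((c : ℚ) : ℝ) * (κ₂ * (Ua - U₁) - (Ua * t₁ - U₁ * ta)) + (κ₂ - 2 * ta) * (Ua * lo₁ - U₁ * H) + ℓ₂ * (2 * ta * (Ua - U₁) - (Ua * t₁ - U₁ * ta)))
    (hP₂ : 0 ≤ 4 * ((c : ℚ) : ℝ) * (κ₂ * (Ua - U₁) - (Ua * t₁ - U₁ * tb)) + (κ₂ - 2 * tb) * (Ua * lo₁ - U₁ * H) + ℓ₂ * (2 * tb * (Ua - U₁) - (Ua * t₁ - U₁ * tb)))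
    (hP₃ : 0 ≤ 4 * ((c : ℚ) : ℝ) * (κ₂ * (Ub - U₁) - (Ub * t₁ - U₁ * ta)) + (κ₂ - 2 * ta) * (Ub * lo₁ - U₁ * H) + ℓ₂ * (2 * ta * (Ub - U₁) - (Ub * t₁ - U₁ * ta)))
    (hP₄ : 0 ≤ 4 * ((c : ℚ) : ℝ) * (κ₂ * (Ub - U₁) - (Ub * t₁ - U₁ * tb)) + (κ₂ - 2 * tb) * (Ub * lo₁ - U₁ * H) + ℓ₂ * (2 * tb * (Ub - U₁) - (Ub * t₁ - U₁ * tb))) :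
    ∀ U ∈ Set.Icc Ua Ub, ∀ t ∈ Set.Icc ta tb, ObsStiffnessSeqCeilingAt t U n c := by
  intro U hU t ht
  have hUlt : U₁ < U := hUa.trans_le hU.1
  have hpos : 0 < (Ub - Ua) * (tb - ta) := mul_pos (sub_pos.2 hab) (sub_pos.2 htab)
  have hbr : U * t₁ - U₁ * t ≤ 2 * t * (U - U₁) := by
    have h := box_corner_interp hU ht (sub_nonneg.2 hbr₁) (sub_nonneg.2 hbr₂) (sub_nonneg.2 hbr₃) (sub_nonneg.2 hbr₄)
    have key : (Ub - Ua) * (tb - ta) * (2 * t * (U - U₁) - (U * t₁ - U₁ * t)) =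
        (Ub - U) * (tb - t) * (2 * ta * (Ua - U₁) - (Ua * t₁ - U₁ * ta)) + (Ub - U) * (t - ta) * (2 * tb * (Ua - U₁) - (Ua * t₁ - U₁ * tb)) +
        (U - Ua) * (tb - t) * (2 * ta * (Ub - U₁) - (Ub * t₁ - U₁ * ta)) + (U - Ua) * (t - ta) * (2 * tb * (Ub - U₁) - (Ub * t₁ - U₁ * tb)) := by
      ring
    have hnn : 0 ≤ (Ub - Ua) * (tb - ta) * (2 * t * (U - U₁) - (U * t₁ - U₁ * t)) := by rw [key]; exact h
    have := (mul_nonneg_iff_of_pos_left hpos).1 hnn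
    linarith
  have hτ' : 2 * t < κ₂ := by linarith [ht.2]
  refine ObsStiffnessSeqCeilingAt_of_targetUChord_fermiSeaRow_right_cleared hU₁0 hUlt hn0 hn2 hfloor (hcapbox U hU t ht) h₂ hbr hτ' c ?_
  have h := box_corner_interp hU ht hP₁ hP₂ hP₃ hP₄
  have key : (Ub - Ua) * (tb - ta) * (4 * ((c : ℚ) : ℝ) * (κ₂ * (U - U₁) - (U * t₁ - U₁ * t)) + (κ₂ - 2 * t) * (U * lo₁ - U₁ * H) +
      ℓ₂ * (2 * t * (U - U₁) - (U * t₁ - U₁ * t))) =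
      (Ub - U) * (tb - t) * (4 * ((c : ℚ) : ℝ) * (κ₂ * (Ua - U₁) - (Ua * t₁ - U₁ * ta)) + (κ₂ - 2 * ta) * (Ua * lo₁ - U₁ * H) + ℓ₂ * (2 * ta * (Ua - U₁) - (Ua * t₁ - U₁ * ta))) +
      (Ub - U) * (t - ta) * (4 * ((c : ℚ) : ℝ) * (κ₂ * (Ua - U₁) - (Ua * t₁ - U₁ * tb)) + (κ₂ - 2 * tb) * (Ua * lo₁ - U₁ * H) + ℓ₂ * (2 * tb * (Ua - U₁) - (Ua * t₁ - U₁ * tb))) +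
      (U - Ua) * (tb - t) * (4 * ((c : ℚ) : ℝ) * (κ₂ * (Ub - U₁) - (Ub * t₁ - U₁ * ta)) + (κ₂ - 2 * ta) * (Ub * lo₁ - U₁ * H) + ℓ₂ * (2 * ta * (Ub - U₁) - (Ub * t₁ - U₁ * ta))) +
      (U - Ua) * (t - ta) * (4 * ((c : ℚ) : ℝ) * (κ₂ * (Ub - U₁) - (Ub * t₁ - U₁ * tb)) + (κ₂ - 2 * tb) * (Ub * lo₁ - U₁ * H) + ℓ₂ * (2 * tb * (Ub - U₁) - (Ub * t₁ - U₁ * tb))) := by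
    ring
  have hnn : 0 ≤ (Ub - Ua) * (tb - ta) * (4 * ((c : ℚ) : ℝ) * (κ₂ * (U - U₁) - (U * t₁ - U₁ * t)) + (κ₂ - 2 * t) * (U * lo₁ - U₁ * H) +
      ℓ₂ * (2 * t * (U - U₁) - (U * t₁ - U₁ * t))) := by rw [key]; exact h
  exact (mul_nonneg_iff_of_pos_left hpos).1 hnn

/-- **BOX WORD at HALF FILLING, `t′ ≤ 0` side** (`n = 1`): the cap is taken from the `t′ = 0` column at a coupling `U₂ ≥ U_b` (`e(1, 0, U₂, 1) ≤ hi₂`, §3), the floor at a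
`t′ = 0` station `U₁ < U_a` (`lo₁ ≤ e(1, 0, U₁, 1)`), the Fermi-sea row at `κ₂ < 2t_a`, `t_b ≤ 0`; four corner checks of
`P(U, t′) = 4c(−U₁t′ − κ₂d) + (2t′ − κ₂)(U·lo₁ − U₁·hi₂) − ℓ₂·t′·(2U − U₁) ≥ 0`. Then `ObsStiffnessSeqCeilingAt t′ U 1 c` on `[U_a, U_b] × [t_a, t_b]`.
[cite: KomaTasaki1994, §1] [cite: ScalapinoWhiteZhang1993, §II] [cite: LiebWuPhysicaA2003, §1 eq. (3)] -/
theorem ObsStiffnessSeqCeilingAt_on_box_halfFilling_targetUChord_left {U₁ lo₁ : ℝ} (hU₁0 : 0 ≤ U₁)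
    (hfloor : lo₁ ≤ energyDensityTT' 1 0 U₁ 1) {κ₂ ℓ₂ : ℝ} (h₂ : ℓ₂ ≤ energyDensityTT' 1 κ₂ 0 1)
    {Ua Ub ta tb U₂ hi₂ : ℝ} (hUa : U₁ < Ua) (hab : Ua < Ub) (hb2 : Ub ≤ U₂) (htab : ta < tb) (htb : tb ≤ 0) (hτ : κ₂ < 2 * ta)
    (hcap : energyDensityTT' 1 0 U₂ 1 ≤ hi₂) (c : ℚ)
    (hP₁ : 0 ≤ 4 * ((c : ℚ) : ℝ) * (-(U₁ * ta) - κ₂ * (Ua - U₁)) + (2 * ta - κ₂) * (Ua * lo₁ - U₁ * hi₂) - ℓ₂ * ta * (2 * Ua - U₁))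
    (hP₂ : 0 ≤ 4 * ((c : ℚ) : ℝ) * (-(U₁ * tb) - κ₂ * (Ua - U₁)) + (2 * tb - κ₂) * (Ua * lo₁ - U₁ * hi₂) - ℓ₂ * tb * (2 * Ua - U₁))
    (hP₃ : 0 ≤ 4 * ((c : ℚ) : ℝ) * (-(U₁ * ta) - κ₂ * (Ub - U₁)) + (2 * ta - κ₂) * (Ub * lo₁ - U₁ * hi₂) - ℓ₂ * ta * (2 * Ub - U₁))
    (hP₄ : 0 ≤ 4 * ((c : ℚ) : ℝ) * (-(U₁ * tb) - κ₂ * (Ub - U₁)) + (2 * tb - κ₂) * (Ub * lo₁ - U₁ * hi₂) - ℓ₂ * tb * (2 * Ub - U₁)) :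
    ∀ U ∈ Set.Icc Ua Ub, ∀ t ∈ Set.Icc ta tb, ObsStiffnessSeqCeilingAt t U 1 c := by
  have hUa0 : 0 ≤ Ua := hU₁0.trans hUa.le
  refine ObsStiffnessSeqCeilingAt_on_box_of_targetUChord_fermiSeaRow_left (t₁ := 0) (n := 1) hU₁0 (by norm_num) (by norm_num) hfloor h₂
    hUa hab htab hτ (H := hi₂) (fun U hU t _ => ?_) ?_ ?_ ?_ ?_ c ?_ ?_ ?_ ?_
  · exact energyDensityTT'_halfFilling_cap_of_tPrime_zero_cap_above t (hUa0.trans hU.1) (hU.2.trans hb2) hcap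
  · nlinarith [hUa.le, htab, htb]
  · nlinarith [hUa.le, htb]
  · nlinarith [hUa.le, hab.le, htab, htb]
  · nlinarith [hUa.le, hab.le, htb]
  · linarith [hP₁, show 4 * ((c : ℚ) : ℝ) * ((Ua * 0 - U₁ * ta) - κ₂ * (Ua - U₁)) + (2 * ta - κ₂) * (Ua * lo₁ - U₁ * hi₂) +
      ℓ₂ * ((Ua * 0 - U₁ * ta) - 2 * ta * (Ua - U₁)) =
      4 * ((c : ℚ) : ℝ) * (-(U₁ * ta) - κ₂ * (Ua - U₁)) + (2 * ta - κ₂) * (Ua * lo₁ - U₁ * hi₂) - ℓ₂ * ta * (2 * Ua - U₁) by ring]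
  · linarith [hP₂, show 4 * ((c : ℚ) : ℝ) * ((Ua * 0 - U₁ * tb) - κ₂ * (Ua - U₁)) + (2 * tb - κ₂) * (Ua * lo₁ - U₁ * hi₂) +
      ℓ₂ * ((Ua * 0 - U₁ * tb) - 2 * tb * (Ua - U₁)) =
      4 * ((c : ℚ) : ℝ) * (-(U₁ * tb) - κ₂ * (Ua - U₁)) + (2 * tb - κ₂) * (Ua * lo₁ - U₁ * hi₂) - ℓ₂ * tb * (2 * Ua - U₁) by ring]
  · linarith [hP₃, show 4 * ((c : ℚ) : ℝ) * ((Ub * 0 - U₁ * ta) - κ₂ * (Ub - U₁)) + (2 * ta - κ₂) * (Ub * lo₁ - U₁ * hi₂) +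
      ℓ₂ * ((Ub * 0 - U₁ * ta) - 2 * ta * (Ub - U₁)) =
      4 * ((c : ℚ) : ℝ) * (-(U₁ * ta) - κ₂ * (Ub - U₁)) + (2 * ta - κ₂) * (Ub * lo₁ - U₁ * hi₂) - ℓ₂ * ta * (2 * Ub - U₁) by ring]
  · linarith [hP₄, show 4 * ((c : ℚ) : ℝ) * ((Ub * 0 - U₁ * tb) - κ₂ * (Ub - U₁)) + (2 * tb - κ₂) * (Ub * lo₁ - U₁ * hi₂) +
      ℓ₂ * ((Ub * 0 - U₁ * tb) - 2 * tb * (Ub - U₁)) =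
      4 * ((c : ℚ) : ℝ) * (-(U₁ * tb) - κ₂ * (Ub - U₁)) + (2 * tb - κ₂) * (Ub * lo₁ - U₁ * hi₂) - ℓ₂ * tb * (2 * Ub - U₁) by ring]

/-- **BOX WORD at HALF FILLING, `t′ ≥ 0` side** (`n = 1`, all sides, no parity condition): cap from the `t′ = 0` column at `U₂ ≥ U_b`, floor at the station `U₁ < U_a`,
Fermi-sea row at `κ₂ > 2t_b` (e.g. a reflected row, `energyDensityTT'_particleHole_one`), `0 ≤ t_a`; four corner checks of
`P′(U, t′) = 4c(κ₂d + U₁t′) + (κ₂ − 2t′)(U·lo₁ − U₁·hi₂) + ℓ₂·t′·(2U − U₁) ≥ 0`. Then `ObsStiffnessSeqCeilingAt t′ U 1 c` on `[U_a, U_b] × [t_a, t_b]`.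
[cite: KomaTasaki1994, §1] [cite: ScalapinoWhiteZhang1993, §II] [cite: LiebWuPhysicaA2003, §1 eq. (3)] -/
theorem ObsStiffnessSeqCeilingAt_on_box_halfFilling_targetUChord_right {U₁ lo₁ : ℝ} (hU₁0 : 0 ≤ U₁)
    (hfloor : lo₁ ≤ energyDensityTT' 1 0 U₁ 1) {κ₂ ℓ₂ : ℝ} (h₂ : ℓ₂ ≤ energyDensityTT' 1 κ₂ 0 1)
    {Ua Ub ta tb U₂ hi₂ : ℝ} (hUa : U₁ < Ua) (hab : Ua < Ub) (hb2 : Ub ≤ U₂) (htab : ta < tb) (hta : 0 ≤ ta) (hτ : 2 * tb < κ₂)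
    (hcap : energyDensityTT' 1 0 U₂ 1 ≤ hi₂) (c : ℚ)
    (hP₁ : 0 ≤ 4 * ((c : ℚ) : ℝ) * (κ₂ * (Ua - U₁) + U₁ * ta) + (κ₂ - 2 * ta) * (Ua * lo₁ - U₁ * hi₂) + ℓ₂ * ta * (2 * Ua - U₁))
    (hP₂ : 0 ≤ 4 * ((c : ℚ) : ℝ) * (κ₂ * (Ua - U₁) + U₁ * tb) + (κ₂ - 2 * tb) * (Ua * lo₁ - U₁ * hi₂) + ℓ₂ * tb * (2 * Ua - U₁))
    (hP₃ : 0 ≤ 4 * ((c : ℚ) : ℝ) * (κ₂ * (Ub - U₁) + U₁ * ta) + (κ₂ - 2 * ta) * (Ub * lo₁ - U₁ * hi₂) + ℓ₂ * ta * (2 * Ub - U₁))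
    (hP₄ : 0 ≤ 4 * ((c : ℚ) : ℝ) * (κ₂ * (Ub - U₁) + U₁ * tb) + (κ₂ - 2 * tb) * (Ub * lo₁ - U₁ * hi₂) + ℓ₂ * tb * (2 * Ub - U₁)) :
    ∀ U ∈ Set.Icc Ua Ub, ∀ t ∈ Set.Icc ta tb, ObsStiffnessSeqCeilingAt t U 1 c := by
  have hUa0 : 0 ≤ Ua := hU₁0.trans hUa.le
  refine ObsStiffnessSeqCeilingAt_on_box_of_targetUChord_fermiSeaRow_right (t₁ := 0) (n := 1) hU₁0 (by norm_num) (by norm_num) hfloor h₂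
    hUa hab htab hτ (H := hi₂) (fun U hU t _ => ?_) ?_ ?_ ?_ ?_ c ?_ ?_ ?_ ?_
  · exact energyDensityTT'_halfFilling_cap_of_tPrime_zero_cap_above t (hUa0.trans hU.1) (hU.2.trans hb2) hcap
  · nlinarith [hUa.le, hta]
  · nlinarith [hUa.le, htab, hta]
  · nlinarith [hUa.le, hab.le, hta]
  · nlinarith [hUa.le, hab.le, htab, hta]
  · linarith [hP₁, show 4 * ((c : ℚ) : ℝ) * (κ₂ * (Ua - U₁) - (Ua * 0 - U₁ * ta)) + (κ₂ - 2 * ta) * (Ua * lo₁ - U₁ * hi₂) +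
      ℓ₂ * (2 * ta * (Ua - U₁) - (Ua * 0 - U₁ * ta)) =
      4 * ((c : ℚ) : ℝ) * (κ₂ * (Ua - U₁) + U₁ * ta) + (κ₂ - 2 * ta) * (Ua * lo₁ - U₁ * hi₂) + ℓ₂ * ta * (2 * Ua - U₁) by ring]
  · linarith [hP₂, show 4 * ((c : ℚ) : ℝ) * (κ₂ * (Ua - U₁) - (Ua * 0 - U₁ * tb)) + (κ₂ - 2 * tb) * (Ua * lo₁ - U₁ * hi₂) +
      ℓ₂ * (2 * tb * (Ua - U₁) - (Ua * 0 - U₁ * tb)) =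
      4 * ((c : ℚ) : ℝ) * (κ₂ * (Ua - U₁) + U₁ * tb) + (κ₂ - 2 * tb) * (Ua * lo₁ - U₁ * hi₂) + ℓ₂ * tb * (2 * Ua - U₁) by ring]
  · linarith [hP₃, show 4 * ((c : ℚ) : ℝ) * (κ₂ * (Ub - U₁) - (Ub * 0 - U₁ * ta)) + (κ₂ - 2 * ta) * (Ub * lo₁ - U₁ * hi₂) +
      ℓ₂ * (2 * ta * (Ub - U₁) - (Ub * 0 - U₁ * ta)) =
      4 * ((c : ℚ) : ℝ) * (κ₂ * (Ub - U₁) + U₁ * ta) + (κ₂ - 2 * ta) * (Ub * lo₁ - U₁ * hi₂) + ℓ₂ * ta * (2 * Ub - U₁) by ring]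
  · linarith [hP₄, show 4 * ((c : ℚ) : ℝ) * (κ₂ * (Ub - U₁) - (Ub * 0 - U₁ * tb)) + (κ₂ - 2 * tb) * (Ub * lo₁ - U₁ * hi₂) +
      ℓ₂ * (2 * tb * (Ub - U₁) - (Ub * 0 - U₁ * tb)) =
      4 * ((c : ℚ) : ℝ) * (κ₂ * (Ub - U₁) + U₁ * tb) + (κ₂ - 2 * tb) * (Ub * lo₁ - U₁ * hi₂) + ℓ₂ * tb * (2 * Ub - U₁) by ring]

end Box

end Summit.Ventures.CertifiedManyBodySolver.Observables

end
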